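import Summits.CriticalPhenomena.PercolationContinuityZ3.Theorems.PercNearOneGluingNoHeavyLowerTailSunflowerMultiPetalKempeMarkedOnePoint
import HarnessLib
import HarnessLib.Audit

/-!
# `NoHeavyLowerTail` (crux stmt-CriticalPhenomena-4575), marked-multigraph layer: the SWAP `Φ_u`, LEMMA B1 and THEOREM MT for marked multigraphs

Support file (seat `prim-l12-p2` gen 47; `--supports stmt-CriticalPhenomena-4575`; continuation of `…KempeMarkedOnePoint` (p594654) and of the simple-graph
swap lemma `tcell_001_le` (p416807, `phiU`)).  No `sorry`; nothing is asserted about the crux.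
Memo: run/shared/lean/prim/prim-l12/prim-l12-p2/FINDING-g47-NEIGHBOURHOOD-CONTRACTION-STEP.md §4, PROOF-LEMMA-B-MARKED-MULTIGRAPHS-g47.md §1.

The swap `Φ_u` (colours `0 ↔ 2` off the terminal `u`) is the transport behind the whole gen-47 proof.  On marked multigraphs (multiplicities and marks)
its effect on the member counts is EXACT (for `σ u = 0`):
* `cntM_phiU_one`:  `#₁(Φ_u σ) = #₁(σ)`;  `cntM_phiU_two`: `#₂(Φ_u σ) + (link₀(u) + mark u) = #₀(σ)`;  `cntM_phiU_zero`: `#₀(Φ_u σ) = #₂(σ) + link₂(u) + mark u`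
  (from `cntM_eq_isolate_add` at `u` and the swapped counts of `K.isolate u`, `cntM_isolate_phiU`, `linkM_phiU`);
* `tcellM`, `TfunM_eq_sum_tcellM` — cells and the cell expansion of `TfunM`;
* **`tcellM_001_le`** — LEMMA B1 for marked multigraphs: `N[001] ≤ N[100] + N[200]`;
* `tcellM_101_le_of_mark` — with a marked terminal, `N[101] ≤ N[200]`;
* **`TfunM_nonneg_of_mark`** — THEOREM MT: `mark u ≠ 0 → 0 ≤ TfunM K u v` (case (c), marked-terminal branch, of the Lemma-B induction of the memo).
-/

namespace Summit.CriticalPhenomena.PercolationContinuityZ3.Theorems.SunflowerPartition.Kempe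

open Finset

namespace MGraph

variable {V : Type*} [Fintype V] [LinearOrder V] (K : MGraph V)

/-! ## The swap `Φ_u` on marked multigraphs: exact count identities, Lemma B1 and THEOREM MT -/

section SwapM

variable (u : V)

/-- In `K.isolate u` the colour-`c` count of `Φ_u σ` is the colour-`sw02 c` count of `σ` (terms at `u` vanish; elsewhere the colours are swapped). [this work] -/
theorem cntM_isolate_phiU (σ : V → Fin 3) (c : Fin 3) :
    (K.isolate u).cntM (phiU u σ) c = (K.isolate u).cntM σ (sw02 c) := by
  have hsw : ∀ w : V, w ≠ u → (phiU u σ w = c ↔ σ w = sw02 c) := by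
    intro w hw
    rw [phiU_of_ne u σ hw]
    constructor
    · intro h; rw [← h, sw02_sw02]
    · intro h; rw [h, sw02_sw02]
  unfold cntM isolate
  simp only
  congr 1
  · refine sum_congr rfl fun x _ => sum_congr rfl fun z _ => ?_
    by_cases hxz : x = u ∨ z = u
    · simp [hxz]
    · push Not at hxz
      simp only [hsw x hxz.1, hsw z hxz.2]
  · refine sum_congr rfl fun x _ => ?_
    by_cases hx : x = u
    · simp [hx]
    · simp only [hsw x hx]

/-- The link counts at `u` swap likewise. [this work] -/
theorem linkM_phiU (σ : V → Fin 3) (c : Fin 3) : K.linkM u (phiU u σ) c = K.linkM u σ (sw02 c) := by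
  unfold linkM
  refine sum_congr rfl fun w _ => ?_
  by_cases hw : w = u
  · simp [hw, K.loopless]
  · rw [phiU_of_ne u σ hw]
    have : (sw02 (σ w) = c) ↔ (σ w = sw02 c) := by
      constructor
      · intro h; rw [← h, sw02_sw02]
      · intro h; rw [h, sw02_sw02]
    simp only [this]

/-- **Swap identities** (for `σ u = 0`): the colour-`1` count is unchanged, … [this work] -/
theorem cntM_phiU_one (σ : V → Fin 3) (hu : σ u = 0) : K.cntM (phiU u σ) 1 = K.cntM σ 1 := by
  rw [K.cntM_eq_isolate_add u (phiU u σ) 1, K.cntM_eq_isolate_add u σ 1, phiU_self, hu, K.cntM_isolate_phiU u σ 1]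
  simp [sw02]

/-- … the colour-`2` count of `Φ_u σ` plus the `0`-members at `u` is the colour-`0` count of `σ`, … [this work] -/
theorem cntM_phiU_two (σ : V → Fin 3) (hu : σ u = 0) :
    K.cntM (phiU u σ) 2 + (K.linkM u σ 0 + K.mark u) = K.cntM σ 0 := by
  rw [K.cntM_eq_isolate_add u (phiU u σ) 2, K.cntM_eq_isolate_add u σ 0, phiU_self, hu, K.cntM_isolate_phiU u σ 2]
  simp [sw02]

/-- … and the colour-`0` count of `Φ_u σ` is the colour-`2` count of `σ` plus the `2`-coloured link of `u` and its marks. [this work] -/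
theorem cntM_phiU_zero (σ : V → Fin 3) (hu : σ u = 0) :
    K.cntM (phiU u σ) 0 = K.cntM σ 2 + (K.linkM u σ 2 + K.mark u) := by
  rw [K.cntM_eq_isolate_add u (phiU u σ) 0, K.cntM_eq_isolate_add u σ 2, phiU_self, hu, K.cntM_isolate_phiU u σ 0, K.linkM_phiU u σ 0]
  simp [sw02]

/-- `tcellM K u v t`: the number of colourings with `σ u = 0`, `σ v = 1` and capped type `t`. [this work] -/
def tcellM (v : V) (t : CType) : ℕ := (univ.filter fun σ : V → Fin 3 => σ u = 0 ∧ σ v = 1 ∧ K.ctypeM σ = t).card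

/-- `TfunM` as a weighted sum of cells. [this work] -/
theorem TfunM_eq_sum_tcellM (v : V) : K.TfunM u v = ∑ t : CType, fC t * (K.tcellM u v t : ℤ) := by
  unfold TfunM tcellM
  rw [← sum_fiberwise_of_maps_to (s := univ.filter fun σ : V → Fin 3 => σ u = 0 ∧ σ v = 1) (t := (univ : Finset CType))
    (g := fun σ => K.ctypeM σ) (fun _ _ => mem_univ _)]
  refine sum_congr rfl fun t _ => ?_
  have hs : (univ.filter fun σ : V → Fin 3 => σ u = 0 ∧ σ v = 1 ∧ K.ctypeM σ = t)
      = (univ.filter fun σ : V → Fin 3 => σ u = 0 ∧ σ v = 1).filter (fun σ => K.ctypeM σ = t) := by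
    ext σ; simp only [mem_filter, mem_univ, true_and, and_assoc]
  rw [hs, sum_congr rfl fun σ hσ => by rw [(mem_filter.1 hσ).2], sum_const, nsmul_eq_mul, mul_comm]

/-- **LEMMA B1 for marked multigraphs**: `N[001] ≤ N[100] + N[200]` via the injection `Φ_u`. [this work] -/
theorem tcellM_001_le (v : V) (huv : u ≠ v) : K.tcellM u v (0, 0, 1) ≤ K.tcellM u v (1, 0, 0) + K.tcellM u v (2, 0, 0) := by
  unfold tcellM
  rw [← card_union_of_disjoint (disjoint_filter.2 fun σ _ h1 h2 => by
    rw [h1.2.2] at h2; exact absurd h2.2.2 (by decide))]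
  rw [← filter_or]
  refine card_le_card_of_injOn (phiU u) (fun σ hσ => ?_) (fun σ₁ _ σ₂ _ h => ?_)
  · rw [mem_coe, mem_filter] at hσ
    obtain ⟨-, hu0, hv1, ht⟩ := hσ
    unfold ctypeM at ht
    simp only [Prod.mk.injEq] at ht
    obtain ⟨hc0, hc1, hc2⟩ := ht
    have h0 : K.cntM σ 0 = 0 := (eq_zero_iff_cap3 _).2 hc0
    have h1 : K.cntM σ 1 = 0 := (eq_zero_iff_cap3 _).2 hc1
    have h2 : K.cntM σ 2 = 1 := (eq_one_iff_cap3 _).2 hc2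
    have hA : phiU u σ u = 0 := by rw [phiU_self, hu0]
    have hB : phiU u σ v = 1 := by rw [phiU_of_ne u σ huv.symm, hv1]; decide
    have e1 := K.cntM_phiU_one u σ hu0
    have e2 := K.cntM_phiU_two u σ hu0
    have e0 := K.cntM_phiU_zero u σ hu0
    have hT1 : cap3 (K.cntM (phiU u σ) 1) = 0 := (eq_zero_iff_cap3 _).1 (by rw [e1, h1])
    have hT2 : cap3 (K.cntM (phiU u σ) 2) = 0 := (eq_zero_iff_cap3 _).1 (by omega)
    have hT0 : cap3 (K.cntM (phiU u σ) 0) ≠ 0 := fun h => by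
      have := (eq_zero_iff_cap3 _).2 h; omega
    rw [mem_coe, mem_filter]
    have key : ∀ z : Fin 3, z ≠ 0 → (z, (0 : Fin 3), (0 : Fin 3)) = ((1 : Fin 3), 0, 0) ∨ (z, (0 : Fin 3), (0 : Fin 3)) = ((2 : Fin 3), 0, 0) := by
      decide
    rcases key _ hT0 with h | h
    · exact ⟨mem_univ _, Or.inl ⟨hA, hB, by unfold ctypeM; rw [hT1, hT2]; exact h⟩⟩
    · exact ⟨mem_univ _, Or.inr ⟨hA, hB, by unfold ctypeM; rw [hT1, hT2]; exact h⟩⟩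
  · have := congrArg (phiU u) h
    rwa [phiU_phiU, phiU_phiU] at this

/-- With a marked terminal `u`, `N[101] ≤ N[200]` via `Φ_u` (the single `0`-member must be the mark at `u`). [this work] -/
theorem tcellM_101_le_of_mark (v : V) (huv : u ≠ v) (hm : K.mark u ≠ 0) : K.tcellM u v (1, 0, 1) ≤ K.tcellM u v (2, 0, 0) := by
  unfold tcellM
  refine card_le_card_of_injOn (phiU u) (fun σ hσ => ?_) (fun σ₁ _ σ₂ _ h => ?_)
  · rw [mem_coe, mem_filter] at hσ
    obtain ⟨-, hu0, hv1, ht⟩ := hσ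
    unfold ctypeM at ht
    simp only [Prod.mk.injEq] at ht
    obtain ⟨hc0, hc1, hc2⟩ := ht
    have h0 : K.cntM σ 0 = 1 := (eq_one_iff_cap3 _).2 hc0
    have h1 : K.cntM σ 1 = 0 := (eq_zero_iff_cap3 _).2 hc1
    have h2 : K.cntM σ 2 = 1 := (eq_one_iff_cap3 _).2 hc2
    have hA : phiU u σ u = 0 := by rw [phiU_self, hu0]
    have hB : phiU u σ v = 1 := by rw [phiU_of_ne u σ huv.symm, hv1]; decide
    have e1 := K.cntM_phiU_one u σ hu0
    have e2 := K.cntM_phiU_two u σ hu0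
    have e0 := K.cntM_phiU_zero u σ hu0
    have hm1 : 1 ≤ K.mark u := Nat.one_le_iff_ne_zero.2 hm
    have hT1 : cap3 (K.cntM (phiU u σ) 1) = 0 := (eq_zero_iff_cap3 _).1 (by rw [e1, h1])
    have hT2 : cap3 (K.cntM (phiU u σ) 2) = 0 := (eq_zero_iff_cap3 _).1 (by omega)
    have hT0 : cap3 (K.cntM (phiU u σ) 0) = 2 := by
      have h2le : 2 ≤ K.cntM (phiU u σ) 0 := by omega
      unfold cap3; ext; simp; omega
    rw [mem_coe, mem_filter]
    exact ⟨mem_univ _, hA, hB, by unfold ctypeM; rw [hT0, hT1, hT2]⟩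
  · have := congrArg (phiU u) h
    rwa [phiU_phiU, phiU_phiU] at this


/-- With `σ u = 0` and a mark at `u`, the type has a nonzero `0`-coordinate. [this work] -/
theorem ctypeM_fst_ne_zero_of_mark (σ : V → Fin 3) (hu : σ u = 0) (hm : K.mark u ≠ 0) : (K.ctypeM σ).1 ≠ 0 := by
  unfold ctypeM
  simp only
  intro h
  have h0 : K.cntM σ 0 = 0 := (eq_zero_iff_cap3 _).2 h
  have := K.cntM_eq_isolate_add u σ 0
  rw [hu] at this
  simp only [if_true] at this
  omega

/-- Pointwise lower bound for the two-terminal weight on types with nonzero `0`-coordinate. (finite check) [this work] -/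
theorem fC_ge_of_fst_ne_zero : ∀ t : CType, t.1 ≠ 0 →
    (if t = (2, 0, 0) then (2 : ℤ) else 0) - (if t = (1, 0, 1) then 1 else 0) ≤ fC t := by decide

/-- A cell count as an indicator sum over the terminal-coloured colourings. [this work] -/
theorem tcellM_eq_sum_ite (v : V) (t : CType) :
    (K.tcellM u v t : ℤ) = ∑ σ ∈ univ.filter (fun σ : V → Fin 3 => σ u = 0 ∧ σ v = 1), (if K.ctypeM σ = t then (1 : ℤ) else 0) := by
  unfold tcellM
  rw [sum_boole]
  congr 1
  have hs : (univ.filter fun σ : V → Fin 3 => σ u = 0 ∧ σ v = 1 ∧ K.ctypeM σ = t)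
      = (univ.filter fun σ : V → Fin 3 => σ u = 0 ∧ σ v = 1).filter (fun σ => K.ctypeM σ = t) := by
    ext σ; simp only [mem_filter, mem_univ, true_and, and_assoc]
  rw [hs]

/-- **THEOREM MT for marked multigraphs**: a marked terminal makes the two-terminal functional nonnegative —
`mark u ≠ 0 → 0 ≤ T(K;u,v)` (memo §4(c); from the injection `N[101] ≤ N[200]`). [this work] -/
theorem TfunM_nonneg_of_mark (v : V) (huv : u ≠ v) (hm : K.mark u ≠ 0) : 0 ≤ K.TfunM u v := by
  have hle := K.tcellM_101_le_of_mark u v huv hm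
  have hbound : (2 : ℤ) * K.tcellM u v (2, 0, 0) - K.tcellM u v (1, 0, 1) ≤ K.TfunM u v := by
    rw [K.tcellM_eq_sum_ite u v (2, 0, 0), K.tcellM_eq_sum_ite u v (1, 0, 1), mul_sum, ← sum_sub_distrib]
    unfold TfunM
    refine sum_le_sum fun σ hσ => ?_
    have hu0 : σ u = 0 := ((mem_filter.1 hσ).2).1
    have h := fC_ge_of_fst_ne_zero (K.ctypeM σ) (K.ctypeM_fst_ne_zero_of_mark u σ hu0 hm)
    have e2 : (2 : ℤ) * (if K.ctypeM σ = (2, 0, 0) then (1 : ℤ) else 0) = (if K.ctypeM σ = (2, 0, 0) then (2 : ℤ) else 0) := by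
      split_ifs <;> simp
    rw [e2]
    exact h
  have hcast : (K.tcellM u v (1, 0, 1) : ℤ) ≤ K.tcellM u v (2, 0, 0) := by exact_mod_cast hle
  have hnn : (0 : ℤ) ≤ K.tcellM u v (2, 0, 0) := by positivity
  linarith

end SwapM

end MGraph

end Summit.CriticalPhenomena.PercolationContinuityZ3.Theorems.SunflowerPartition.Kempe
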